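import Mathlib
import HarnessLib

set_option linter.dupNamespace false -- `Summit.BirchSwinnertonDyer.BirchSwinnertonDyer.Theorems.…` (summit = sub)
set_option autoImplicit false

/-!
# Crux (E♭°) `EisensteinDivisibilityCMInertBadFlatAtOne` — the arithmetic core of the HEART obstruction:
# a level-2 fundamental character at an inert CM prime is never a Teichmüller power, for any fibre order

Helper for item stmt-BirchSwinnertonDyer-20452 (route `BiquadraticEisensteinDescent`, line `birth`,
heart `stub_E1B` = rev-10β child `EisensteinHeartCMInertBad`). Lead-prover seat bsd-wall-bed-p1 g4,
2026-08-27; companion memo `HEART-OBSTRUCTION-20452-g4.md` (evidence #13 on the item).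

## What this certifies

The heart of the line is the Eisenstein half of the Iwasawa main conjecture for the quartic CM field
`L = K_CM·K′` with the `K′`-induced (p-ordinary) CM type `Σ′`, on the branch `θ_W` of `ψ_W ∘ N_{L/K_CM}`.
The only printed divisibility of that shape — Hsieh, JAMS 27 (2014) Thm 2, completed by
Burungale–Hsieh–Tian–Yang arXiv:2508.19706 Thm 1.6 — requires hypothesis (2): "`ψ` unramified at `Σ_p^c`
and `ψ·ω^{-a}` unramified at `Σ_p` for some integer `a`". For a CM curve `W = W₀ ⊗ χ` with `p ≥ 5` INERT
in `K_CM` (`W₀` the good supersingular twin at `p`, `χ` the character of the additive fibre, of order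
`e ∈ {1,2,3,4,6}`), the formal group of `W₀` over `ℤ_{p²}` is Lubin–Tate of height 2, so the branch
restricted to the inertia group at EITHER prime of `L` over `p` is `ū ↦ σ̄₁(ū)^{-1}·χ̄(ū)` on the tame
quotient `𝔽_{p²}^×` (a level-2 fundamental character times a character of order `e`, i.e. with exponent
`-1 + k·(p²-1)/e` for some `k`), while every power of the Teichmüller character restricts to
`ū ↦ ū^{a(p+1)}` (it factors through the norm to `𝔽_p^×`). Hypothesis (2) at `Σ_p` would therefore need
integers `k, a` with `-1 + k·(p²-1)/e ≡ a·(p+1) (mod p²-1)`, and at `Σ_p^c` it would need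
`-1 + k·(p²-1)/e ≡ 0 (mod p²-1)`. Reducing modulo `p + 1`, both would force `p + 1 ∣ k·(p²-1)/e - 1`.
The theorems below show this divisibility is IMPOSSIBLE for every prime `p ≥ 5`, every admissible fibre
order `e` and every `k` (and likewise with `+1`, the exponent of the conjugate embedding `σ̄₂ = σ̄₁^p`,
since `-p ≡ 1 (mod p+1)`): hypothesis (2) fails in both clauses for every member of the class and for
its good-reduction twin, and no Teichmüller twist repairs it. (Sanity: in the printed ORDINARY case,
`p` split in the CM field, the branch is `ω` itself at `Σ_p` and unramified at `Σ_p^c`.)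

The Galois-theoretic identification (Lubin–Tate character of height 2; both decomposition groups of `L`
over `p` mapping onto `G_{ℚ_{p²}}` and seeing the same character) is on paper in the memo; this file
is the elementary number theory it reduces to, kernel-checked so that later seats need not re-derive it.

## Contents
* `not_succ_dvd_mul_div_sub_one` : `¬ (p+1 : ℤ) ∣ k * ((p^2-1)/e) - 1`;
* `not_succ_dvd_mul_div_add_one` : `¬ (p+1 : ℤ) ∣ k * ((p^2-1)/e) + 1`;
* `not_exists_teichmueller_exponent` : no `k, a` with `(p^2-1 : ℤ) ∣ -1 + k * ((p^2-1)/e) - a * (p+1)`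
  (the `Σ_p`-clause) — and with `a = 0` the `Σ_p^c`-clause.

References (prose, first-hand in the memo): Hsieh, J. Amer. Math. Soc. 27 (2014) Thm 2 + Remark p. 3;
Burungale–Hsieh–Tian–Yang, arXiv:2508.19706 (2025) Thm 1.6, Thm 6.7, Remarks 1.7/6.6; de Shalit,
Iwasawa theory of elliptic curves with CM (1987) Ch. I §1–3 (Lubin–Tate characters); Serre, Invent.
Math. 15 (1972) §1 (fundamental characters of level 2).
-/

namespace Summit.BirchSwinnertonDyer.BirchSwinnertonDyer.Theorems.BiquadraticEisensteinDescentEisensteinDivisibilityCMInertBadFlatAtOneBranchObstruction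

/-- **Core divisibility obstruction.** For a prime `p ≥ 5`, a fibre order `0 < e ≤ 6` with `e ∣ p² - 1` and
`M = (p² - 1)/e`, no integer `k` has `p + 1 ∣ k·M - 1`. Proof: such a `k` makes `p + 1` coprime to `M`;
as `p + 1 ∣ M·e = p² - 1` this gives `p + 1 ∣ e ≤ 6`, so `p = 5`, `e = 6`, `M = 4`, and `6 ∣ 4k - 1` is
absurd by parity. This is the `Σ_p`/`Σ_p^c`-clause of hypothesis (2) of Hsieh 2014 Thm 2 =
Burungale–Hsieh–Tian–Yang 2025 Thm 1.6 for the embedding `σ̄₁`, read modulo `p + 1`. [folklore] -/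
theorem not_succ_dvd_mul_div_sub_one {p e : ℕ} (hp : p.Prime) (h5 : 5 ≤ p) (he0 : 0 < e) (he6 : e ≤ 6)
    (hdvd : e ∣ p ^ 2 - 1) (k : ℤ) : ¬ ((p + 1 : ℤ) ∣ k * ((p ^ 2 - 1) / e : ℕ) - 1) := by
  intro h
  set M : ℕ := (p ^ 2 - 1) / e with hM
  have hMe : M * e = p ^ 2 - 1 := Nat.div_mul_cancel hdvd
  -- `p + 1` and `M` are coprime (as integers)
  have hcop : IsCoprime (p + 1 : ℤ) (M : ℤ) := by
    rw [Int.isCoprime_iff_gcd_eq_one]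
    have hg1 : ((Int.gcd (p + 1 : ℤ) (M : ℤ) : ℕ) : ℤ) ∣ (p + 1 : ℤ) := Int.gcd_dvd_left _ _
    have hg2 : ((Int.gcd (p + 1 : ℤ) (M : ℤ) : ℕ) : ℤ) ∣ (M : ℤ) := Int.gcd_dvd_right _ _
    have hg3 : ((Int.gcd (p + 1 : ℤ) (M : ℤ) : ℕ) : ℤ) ∣ 1 := by
      have h1 : ((Int.gcd (p + 1 : ℤ) (M : ℤ) : ℕ) : ℤ) ∣ k * (M : ℤ) - 1 := dvd_trans hg1 h
      have h2 : ((Int.gcd (p + 1 : ℤ) (M : ℤ) : ℕ) : ℤ) ∣ k * (M : ℤ) := dvd_mul_of_dvd_right hg2 k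
      have := dvd_sub h2 h1
      simpa using this
    have : Int.gcd (p + 1 : ℤ) (M : ℤ) ∣ 1 := by exact_mod_cast hg3
    exact Nat.dvd_one.mp this
  -- `p + 1 ∣ M * e` since `M * e = p^2 - 1 = (p - 1)(p + 1)`
  have hp1 : 1 ≤ p := hp.one_lt.le
  have hsq : ((p ^ 2 - 1 : ℕ) : ℤ) = ((p : ℤ) - 1) * ((p : ℤ) + 1) := by
    have : 1 ≤ p ^ 2 := Nat.one_le_pow _ _ hp.pos
    push_cast [Nat.cast_sub this]
    ring
  have hdvdMe : (p + 1 : ℤ) ∣ (M : ℤ) * (e : ℤ) := by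
    have : ((M * e : ℕ) : ℤ) = ((p : ℤ) - 1) * ((p : ℤ) + 1) := by rw [hMe]; exact hsq
    rw [← Nat.cast_mul, this]
    exact Dvd.intro_left _ rfl
  -- hence `p + 1 ∣ e`
  have hdvde : (p + 1 : ℤ) ∣ (e : ℤ) := hcop.dvd_of_dvd_mul_left hdvdMe
  have hdvde' : p + 1 ∣ e := by exact_mod_cast hdvde
  have hle : p + 1 ≤ e := Nat.le_of_dvd he0 hdvde'
  -- so `p = 5` and `e = 6`
  have hp5 : p = 5 := by omega
  have he6' : e = 6 := by omega
  subst hp5 he6'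
  -- `M = 24 / 6 = 4`, and `6 ∣ 4k - 1` is impossible (parity)
  have hM4 : M = 4 := by simp [hM]
  rw [hM4] at h
  omega

/-- **The conjugate-embedding clause.** Same as `not_succ_dvd_mul_div_sub_one` with `+ 1` in place of
`- 1`: the branch read through the other embedding `σ̄₂ = σ̄₁^p` has exponent `-p + k·(p²-1)/e`, and
`-p ≡ 1 (mod p + 1)`. [folklore] -/
theorem not_succ_dvd_mul_div_add_one {p e : ℕ} (hp : p.Prime) (h5 : 5 ≤ p) (he0 : 0 < e) (he6 : e ≤ 6)
    (hdvd : e ∣ p ^ 2 - 1) (k : ℤ) : ¬ ((p + 1 : ℤ) ∣ k * ((p ^ 2 - 1) / e : ℕ) + 1) := by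
  intro h
  have h' : (p + 1 : ℤ) ∣ (-k) * ((p ^ 2 - 1) / e : ℕ) - 1 := by
    have hneg := dvd_neg.mpr h
    have hrw : -(k * (((p ^ 2 - 1) / e : ℕ) : ℤ) + 1) = (-k) * (((p ^ 2 - 1) / e : ℕ) : ℤ) - 1 := by
      ring
    rwa [hrw] at hneg
  exact not_succ_dvd_mul_div_sub_one hp h5 he0 he6 hdvd (-k) h'

/-- **No Teichmüller exponent.** For a prime `p ≥ 5` and a fibre order `0 < e ≤ 6`, `e ∣ p² - 1`, there
are NO integers `k, a` with `p² - 1 ∣ -1 + k·(p²-1)/e - a·(p+1)`: the character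
`ū ↦ σ̄₁(ū)^{-1}·χ̄(ū)` of `𝔽_{p²}^×` (exponent `-1 + k(p²-1)/e`) is not the restriction `ū ↦ ū^{a(p+1)}`
of any power `ω^a` of the Teichmüller character — the `Σ_p`-clause of hypothesis (2) of Hsieh 2014
Thm 2 / Burungale–Hsieh–Tian–Yang 2025 Thm 1.6 fails for the branch of every `p`-inert CM curve,
whatever the additive fibre; with `a = 0` it is the `Σ_p^c`-clause (the branch is ramified there).
[folklore] -/
theorem not_exists_teichmueller_exponent {p e : ℕ} (hp : p.Prime) (h5 : 5 ≤ p)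
    (he0 : 0 < e) (he6 : e ≤ 6) (hdvd : e ∣ p ^ 2 - 1) :
    ¬ ∃ k a : ℤ, ((p ^ 2 - 1 : ℕ) : ℤ) ∣ -1 + k * ((p ^ 2 - 1) / e : ℕ) - a * (p + 1) := by
  rintro ⟨k, a, h⟩
  -- `p + 1 ∣ p^2 - 1`
  have hsq : (p + 1 : ℤ) ∣ ((p ^ 2 - 1 : ℕ) : ℤ) := by
    have : 1 ≤ p ^ 2 := Nat.one_le_pow _ _ hp.pos
    refine ⟨(p : ℤ) - 1, ?_⟩
    push_cast [Nat.cast_sub this]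
    ring
  have h1 : (p + 1 : ℤ) ∣ -1 + k * ((p ^ 2 - 1) / e : ℕ) - a * (p + 1) := dvd_trans hsq h
  have h2 : (p + 1 : ℤ) ∣ a * (p + 1) := Dvd.intro_left _ rfl
  have h3 : (p + 1 : ℤ) ∣ k * ((p ^ 2 - 1) / e : ℕ) - 1 := by
    have := dvd_add h1 h2
    have hrw : -1 + k * ((p ^ 2 - 1) / e : ℕ) - a * (p + 1) + a * (p + 1)
        = k * (((p ^ 2 - 1) / e : ℕ) : ℤ) - 1 := by ring
    rwa [hrw] at this
  exact not_succ_dvd_mul_div_sub_one hp h5 he0 he6 hdvd k h3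

/-- **The `Σ_p^c`-clause by itself**: the branch is ramified at the conjugate prime — no `k` makes the
exponent `-1 + k·(p²-1)/e` divisible by `p² - 1`. [folklore] -/
theorem not_exists_unramified_exponent {p e : ℕ} (hp : p.Prime) (h5 : 5 ≤ p)
    (he0 : 0 < e) (he6 : e ≤ 6) (hdvd : e ∣ p ^ 2 - 1) :
    ¬ ∃ k : ℤ, ((p ^ 2 - 1 : ℕ) : ℤ) ∣ -1 + k * ((p ^ 2 - 1) / e : ℕ) := by
  rintro ⟨k, h⟩
  refine not_exists_teichmueller_exponent hp h5 he0 he6 hdvd ⟨k, 0, ?_⟩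
  simpa using h

end Summit.BirchSwinnertonDyer.BirchSwinnertonDyer.Theorems.BiquadraticEisensteinDescentEisensteinDivisibilityCMInertBadFlatAtOneBranchObstruction
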